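import Mathlib
import Literature.AlgebraicGeometry.Resolution.FormalInverseFunction
import Summits.ResolutionOfSingularities.ResolutionOfSingularities.Theorems.WeightedInvariantLocalWeightedDropMonicDescentBridgeTools
import Summits.ResolutionOfSingularities.ResolutionOfSingularities.Theorems.WeightedInvariantLocalWeightedDropNCPolyBridgeCharts
import Summits.ResolutionOfSingularities.ResolutionOfSingularities.Theorems.WeightedInvariantLocalWeightedDropNCBranchPrimesFinite

/-!
# `LocalWeightedDrop`, TOT2-LINE regime (P), piece (β-prime) — THE READING: a graph datum `(h, ψ)` of a label gives a non-maximal prime `P`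
# with `monicGerm d A ∈ P^d`, injectively in `h`

Crux item stmt-ResolutionOfSingularities-8899 `WeightedInvariant.LocalWeightedDrop` (route `ResolutionOfSingularities/WeightedInvariant`), ENGINE
skeleton v33 (35b29332b4d99231), registered stub `stub_regimePresented`, piece (P3) (res-type-088's conflict budget; NAMING res-type-088
2026-08-27T16:46:34Z (4): «the reading u₁-graph datum h ↦ P_h := ker(y ↦ −φ_h, u₂ ↦ −u₁h) injective — this is the index set the δ-term of M needs»).
[OURS · L1 W4.3 · chain w43 · seat res-L1-w43-stub-1 gen 6; def-free; the tree's coordinate changes `MonicDescent.shear3` (u₂ ↦ u₂ + u₁h),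
`NCPoly.recentre` (y ↦ y + ψ) and their bridges to `PolyDescent.shearT` / `WildMonic.shift`, the formal inverse function theorem
`FormalCoordChange.exists_comp_inverse` (Literature), and `…NCBranchPrimesFinite`; nothing here is a statement of any manuscript; AI-produced,
gate-checked, weaker than expert review.]

THE OBJECTS.  For a `u₂`-free `h` and `ψ ∈ k⟦u₁,u₂⟧` with `ψ(0) = 0` let `σ = σ_{h,ψ}` be the substitution `F(u₁,u₂,y) ↦ F(u₁, u₂ + u₁h, y + ψ)`
(`subst (recentre ψ) ∘ subst (shear3 h)`) and `κ` the evaluation `u₂, y ↦ 0`.  THE PRIME OF THE DATUM is `P := ker (κ ∘ σ)` — the ideal of the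
branch curve `{u₂ = u₁h, y = −ψ-graph}` — given below WITHOUT a definition, through its defining ring homomorphism.

* `subst_shear3_monicGerm` — `σ` carries `monicGerm d A` to `monicGerm d (shift d (shearT h A) ψ)` (with `NCPoly.subst_recentre_monicGerm`);
* `monicGerm_mem_pow_of_isPermissibleTwoT` — a `V(y,u₂)`-permissible label has `monicGerm d B ∈ Q^d` for every ideal `Q ∋ u₂, y`;
* `mem_pow_of_inverse` — transport of `σ b ∈ Q^d` to `b ∈ P^d` along a two-sided inverse of `σ` (`FormalCoordChange.exists_comp_inverse`);
* **`exists_prime_of_graphDatum`** — for a graph datum (`IsPermissibleTwoT d (shift d (shearT h A) ψ)`): the kernel `P` of `κ ∘ σ_{h,ψ}` is prime,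
  `P ≠ 𝔪` (`u₁ ∉ P`), `monicGerm d A ∈ P^d`, `u₂ − u₁h ∈ P`, and `P` meets `k⟦u₁⟧` trivially;
* **`eq_of_sub_mem_of_sub_mem`** — a prime not containing `u₁` and meeting `k⟦u₁⟧` trivially contains `u₂ − u₁h` for at most ONE `u₂`-free `h`:
  the reading `h ↦ P_h` is injective;
* **`finite_graphData`** — hence (with `NCBranchPrimes.finite_primes_of_mem_pow`, p552712) for EVERY label `A : Fin d → k⟦u₁,u₂⟧`, `d ≥ 2`, with
  squarefree monic germ over a perfect field of characteristic `p`, the set of `u₂`-free `h` carrying a u₁-graph datum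
  (`∃ ψ, ψ(0) = 0 ∧ IsPermissibleTwoT d (shift d (shearT h A) ψ)`) is FINITE — a second route to (B1), through primes, valid for mixed and purely
  inseparable degrees alike (cf. `TOT2Curve.finite_curveRoots` p547036 + the branch witnesses p549582 / p550427).
-/

set_option linter.dupNamespace false -- mandated namespace of this single-conjunct summit

noncomputable section

namespace Summit.ResolutionOfSingularities.ResolutionOfSingularities.Theorems

namespace NCBranchPrimes

open MvPowerSeries PolyDescent MonicDescent WildMonic NCPoly Literature.AlgebraicGeometry.Resolution

variable {k : Type} [Field k]

/-! ## The coordinate change of a graph datum on monic germs -/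

/-- `shear3 h` is the extension by `y ↦ y` of the plane shear family. -/
theorem shear3_eq_extendLast (h : MvPowerSeries (Fin 2) k) :
    shear3 h = extendLast (![X 0, X 1 + X 0 * h] : Fin 2 → MvPowerSeries (Fin 2) k) := by
  funext l
  refine Fin.lastCases ?_ (fun i => ?_) l
  · show shear3 h (Fin.last 2) = extendLast _ (Fin.last 2)
    rw [extendLast, Fin.lastCases_last]
    rfl
  · rw [extendLast_castSucc]
    fin_cases i
    · show shear3 h 0 = rename _ (X 0)
      rw [rename_X]
      rfl
    · show shear3 h 1 = rename _ (X 1 + X 0 * h)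
      rw [map_add, map_mul, rename_X, rename_X]
      rfl

/-- `(u₂ ↦ u₂ + u₁h)` carries `monicGerm d A` to `monicGerm d (shearT h A)`. -/
theorem subst_shear3_monicGerm (h : MvPowerSeries (Fin 2) k) (d : ℕ) (A : Fin d → MvPowerSeries (Fin 2) k) :
    subst (shear3 h) (monicGerm d A) = monicGerm d (shearT h A) := by
  rw [shear3_eq_extendLast, subst_extendLast_monicGerm _ (constantCoeff_shearFamily h)]
  congr 1
  funext j
  rw [shearT, shear_eq]

/-- The substitution of a graph datum carries `monicGerm d A` to the germ of the re-centred sheared label. -/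
theorem subst_recentre_subst_shear3_monicGerm (h : MvPowerSeries (Fin 2) k) {ψ : MvPowerSeries (Fin 2) k} (hψ : constantCoeff ψ = 0) (d : ℕ)
    (A : Fin d → MvPowerSeries (Fin 2) k) :
    subst (recentre ψ) (subst (shear3 h) (monicGerm d A)) = monicGerm d (shift d (shearT h A) ψ) := by
  rw [subst_shear3_monicGerm, subst_recentre_monicGerm hψ]

/-! ## Permissible germs lie in `(u₂, y)^d` -/

/-- A `V(y,u₂)`-permissible label has its monic germ in `Q^d` for every ideal `Q` containing `u₂` and `y`. -/
theorem monicGerm_mem_pow_of_isPermissibleTwoT {d : ℕ} {B : Fin d → MvPowerSeries (Fin 2) k} (hB : IsPermissibleTwoT d B)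
    {Q : Ideal (MvPowerSeries (Fin 3) k)} (h1 : (X 1 : MvPowerSeries (Fin 3) k) ∈ Q) (h2 : (X (Fin.last 2) : MvPowerSeries (Fin 3) k) ∈ Q) :
    monicGerm d B ∈ Q ^ d := by
  rw [monicGerm]
  refine Ideal.add_mem _ (Ideal.pow_mem_pow h2 d) (Ideal.sum_mem _ fun j _ => ?_)
  obtain ⟨C, hC⟩ := (TOT2Curve.isPermissibleTwoT_iff_X_pow_dvd B).mp hB j
  have hQ : Q ^ d = Q ^ (d - (j : ℕ)) * Q ^ (j : ℕ) := by
    rw [← pow_add, Nat.sub_add_cancel j.2.le]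
  rw [hC, map_mul, map_pow, rename_X, show (Fin.succAboveEmb (Fin.last 2)) (1 : Fin 2) = (1 : Fin 3) from rfl, mul_assoc, hQ]
  exact Ideal.mul_mem_mul (Ideal.pow_mem_pow h1 _) (Ideal.mul_mem_left _ _ (Ideal.pow_mem_pow h2 _))

/-! ## Transport along an invertible substitution -/

/-- If `τ ∘ σ = id` and `τ(Q) ⊆ P`, then `σ b ∈ Q^d` gives `b ∈ P^d`. -/
theorem mem_pow_of_inverse {R : Type*} [CommRing R] (σ τ : R →+* R) (hτσ : ∀ x, τ (σ x) = x) {Q P : Ideal R} (hQP : ∀ q ∈ Q, τ q ∈ P)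
    {b : R} {d : ℕ} (hb : σ b ∈ Q ^ d) : b ∈ P ^ d := by
  have h1 : b ∈ Ideal.map τ (Q ^ d) := by
    rw [← hτσ b]
    exact Ideal.mem_map_of_mem τ hb
  rw [Ideal.map_pow] at h1
  exact Ideal.pow_right_mono (Ideal.map_le_iff_le_comap.mpr fun q hq => hQP q hq) d h1

/-- The identity substitution. -/
theorem subst_X_self {n : ℕ} (F : MvPowerSeries (Fin n) k) : subst (X : Fin n → MvPowerSeries (Fin n) k) F = F := by
  rw [← map_algebraMap_eq_subst_X, Algebra.algebraMap_self, MvPowerSeries.map_id]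
  rfl

/-- A legal substitution of `k⟦X₀,X₁,X₂⟧` (zero constant terms, invertible linear part) has a two-sided inverse: as ring endomorphisms
`τ ∘ σ = id = σ ∘ τ` (`FormalCoordChange.exists_comp_inverse`). -/
theorem exists_inverse_ringHom {θ : Fin 3 → MvPowerSeries (Fin 3) k} (h0 : ∀ i, constantCoeff (θ i) = 0)
    (hdet : IsUnit (FormalCoordChange.linMat θ).det) :
    ∃ τ : MvPowerSeries (Fin 3) k →+* MvPowerSeries (Fin 3) k,
      (∀ x, τ (subst θ x) = x) ∧ (∀ x, subst θ (τ x) = x) := by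
  obtain ⟨ψ, hψ0, hψθ, hθψ⟩ := FormalCoordChange.exists_comp_inverse h0 hdet
  have hθ : HasSubst θ := hasSubst_of_constantCoeff_zero h0
  have hψ : HasSubst ψ := hasSubst_of_constantCoeff_zero hψ0
  refine ⟨(substAlgHom hψ).toRingHom, fun x => ?_, fun x => ?_⟩
  · change (substAlgHom hψ) (subst θ x) = x
    rw [coe_substAlgHom hψ, subst_comp_subst_apply hθ hψ, show (fun s => subst ψ (θ s)) = X from funext hψθ, subst_X_self]
  · change subst θ ((substAlgHom hψ) x) = x
    rw [coe_substAlgHom hψ, subst_comp_subst_apply hψ hθ, show (fun s => subst θ (ψ s)) = X from funext hθψ, subst_X_self]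

/-! ## The evaluation `κ : u₂, y ↦ 0`; plane series -/

/-- The kill family `(u₁, u₂, y) ↦ (u₁, 0, 0)` is substitutable. -/
theorem hasSubst_killTwoThree : HasSubst (![X 0, 0, 0] : Fin 3 → MvPowerSeries (Fin 3) k) :=
  hasSubst_of_constantCoeff_zero fun i => by fin_cases i <;> simp [constantCoeff_X]

/-- `κ` on a renamed plane series is the renamed `u₂`-free part. -/
theorem subst_kill_rename (G : MvPowerSeries (Fin 2) k) :
    subst (![X 0, 0, 0] : Fin 3 → MvPowerSeries (Fin 3) k) (rename (Fin.succAboveEmb (Fin.last 2)) G) =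
      rename (Fin.succAboveEmb (Fin.last 2)) (subst (![X 0, 0] : Fin 2 → MvPowerSeries (Fin 2) k) G) := by
  rw [rename_eq_subst, subst_comp_subst_apply (HasSubst.X_comp _) hasSubst_killTwoThree, rename_eq_subst,
    subst_comp_subst_apply TOT2Curve.hasSubst_killTwo (HasSubst.X_comp _)]
  congr 1
  funext i
  rw [Function.comp_apply, subst_X hasSubst_killTwoThree]
  fin_cases i
  · show (![X 0, 0, 0] : Fin 3 → MvPowerSeries (Fin 3) k) 0 = subst _ (X 0)
    rw [subst_X (HasSubst.X_comp _)]
    rfl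
  · show (![X 0, 0, 0] : Fin 3 → MvPowerSeries (Fin 3) k) 1 = subst _ 0
    rw [← coe_substAlgHom (HasSubst.X_comp _), map_zero]
    rfl

/-- The re-centring `y ↦ y + ψ` fixes plane series. -/
theorem subst_recentre_rename {ψ : MvPowerSeries (Fin 2) k} (hψ : constantCoeff ψ = 0) (G : MvPowerSeries (Fin 2) k) :
    subst (recentre ψ) (rename (Fin.succAboveEmb (Fin.last 2)) G) = rename (Fin.succAboveEmb (Fin.last 2)) G := by
  have hS : HasSubst (recentre ψ) := hasSubst_of_constantCoeff_zero (constantCoeff_recentre hψ)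
  rw [rename_eq_subst, subst_comp_subst_apply (HasSubst.X_comp _) hS]
  congr 1
  funext i
  rw [Function.comp_apply, subst_X hS]
  exact recentre_of_ne ψ (Fin.succAbove_ne (Fin.last 2) i)

/-- `u₁` is not zero. -/
theorem X_zero_ne_zero : (X 0 : MvPowerSeries (Fin 3) k) ≠ 0 := fun h => by
  have h1 := congrArg (coeff (Finsupp.single 0 1)) h
  rw [coeff_X, if_pos rfl, map_zero] at h1
  exact one_ne_zero h1

/-! ## The prime of a graph datum -/

/-- **THE PRIME OF A GRAPH DATUM.**  Let `h` be `u₂`-free, `ψ(0) = 0`, and the re-centred sheared label `shift d (shearT h A) ψ` be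
`V(y,u₂)`-permissible (a u₁-graph datum of `A`).  Then there is a prime `P` of `k⟦u₁,u₂,y⟧` — the ideal of the branch, the kernel of
`F ↦ F(u₁, u₂ + u₁h, y + ψ)|_{u₂ = y = 0}` — with: `P ≠ 𝔪`; `monicGerm d A ∈ P^d`; `u₂ − u₁h ∈ P`; `u₁ ∉ P`; and `P` meets the `u₂`-free
plane series only in `0`.  (The last three make the reading `h ↦ P` injective: `eq_of_sub_mem_of_sub_mem`.) -/
theorem exists_prime_of_graphDatum {d : ℕ} (A : Fin d → MvPowerSeries (Fin 2) k) {h ψ : MvPowerSeries (Fin 2) k}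
    (hh : ∀ e : Fin 2 →₀ ℕ, e 1 ≠ 0 → coeff e h = 0) (hψ : constantCoeff ψ = 0) (hperm : IsPermissibleTwoT d (shift d (shearT h A) ψ)) :
    ∃ P : Ideal (MvPowerSeries (Fin 3) k), P.IsPrime ∧ P ≠ IsLocalRing.maximalIdeal (MvPowerSeries (Fin 3) k) ∧ monicGerm d A ∈ P ^ d ∧
      (X 1 - X 0 * rename (Fin.succAboveEmb (Fin.last 2)) h ∈ P) ∧ (X 0 ∉ P) ∧
      (∀ G : MvPowerSeries (Fin 2) k, (∀ e : Fin 2 →₀ ℕ, e 1 ≠ 0 → coeff e G = 0) → rename (Fin.succAboveEmb (Fin.last 2)) G ∈ P → G = 0) := by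
  have hS1 : HasSubst (shear3 h) := hasSubst_of_constantCoeff_zero (constantCoeff_shear3 h)
  have hS2 : HasSubst (recentre ψ) := hasSubst_of_constantCoeff_zero (constantCoeff_recentre hψ)
  -- the substitution `σ` of the datum and the evaluation `κ`
  set σ : MvPowerSeries (Fin 3) k →+* MvPowerSeries (Fin 3) k := (substAlgHom hS2).toRingHom.comp (substAlgHom hS1).toRingHom with hσdef
  have hσ : ∀ F, σ F = subst (recentre ψ) (subst (shear3 h) F) := by
    intro F
    rw [hσdef, RingHom.comp_apply]
    change (substAlgHom hS2) ((substAlgHom hS1) F) = _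
    rw [coe_substAlgHom hS1, coe_substAlgHom hS2]
  set κ : MvPowerSeries (Fin 3) k →+* MvPowerSeries (Fin 3) k := (substAlgHom (hasSubst_killTwoThree (k := k))).toRingHom with hκdef
  have hκ : ∀ F, κ F = subst (![X 0, 0, 0] : Fin 3 → MvPowerSeries (Fin 3) k) F := by
    intro F
    rw [hκdef]
    change (substAlgHom hasSubst_killTwoThree) F = _
    rw [coe_substAlgHom]
  -- values of `σ` and `κ`
  have hσX0 : σ (X 0) = X 0 := by
    rw [hσ, subst_X hS1, show shear3 h 0 = X 0 from rfl, subst_X hS2, recentre_of_ne ψ (by decide)]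
  have hσh : subst (shear3 h) (rename (Fin.succAboveEmb (Fin.last 2)) h) = rename (Fin.succAboveEmb (Fin.last 2)) h := by
    rw [subst_shear3_rename, shear_eq_self_of_noY h h hh]
  have hσX1 : σ (X 1 - X 0 * rename (Fin.succAboveEmb (Fin.last 2)) h) = X 1 := by
    rw [hσ, ← coe_substAlgHom hS1, map_sub, map_mul, coe_substAlgHom hS1, subst_X hS1, subst_X hS1, hσh,
      show shear3 h 1 = X 1 + X 0 * rename (Fin.succAboveEmb (Fin.last 2)) h from rfl, show shear3 h 0 = X 0 from rfl, add_sub_cancel_right,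
      subst_X hS2, recentre_of_ne ψ (by decide)]
  have hκX0 : κ (X 0) = X 0 := by rw [hκ, subst_X hasSubst_killTwoThree]; rfl
  have hκX1 : κ (X 1) = 0 := by rw [hκ, subst_X hasSubst_killTwoThree]; rfl
  have hκX2 : κ (X (Fin.last 2)) = 0 := by rw [hκ, subst_X hasSubst_killTwoThree]; rfl
  -- two-sided inverses of the two factors of `σ`
  obtain ⟨τ₁, hτ₁l, hτ₁r⟩ := exists_inverse_ringHom (constantCoeff_shear3 h) (by rw [det_linMat_shear3]; exact isUnit_one)
  obtain ⟨τ₂, hτ₂l, hτ₂r⟩ := exists_inverse_ringHom (constantCoeff_recentre hψ) (isUnit_det_linMat_recentre ψ)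
  have hτσ : ∀ x, (τ₁.comp τ₂) (σ x) = x := fun x => by rw [hσ, RingHom.comp_apply, hτ₂l, hτ₁l]
  have hστ : ∀ x, σ ((τ₁.comp τ₂) x) = x := fun x => by rw [hσ, RingHom.comp_apply, hτ₁r, hτ₂r]
  haveI : IsDomain (MvPowerSeries (Fin 3) k) := NoZeroDivisors.to_isDomain _
  refine ⟨RingHom.ker (κ.comp σ), RingHom.ker_isPrime _, ?_, ?_, ?_, ?_, ?_⟩
  · -- `P ≠ 𝔪`: `u₁ ∈ 𝔪 \ P`
    intro hP
    have h1 : (X 0 : MvPowerSeries (Fin 3) k) ∈ RingHom.ker (κ.comp σ) := by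
      rw [hP, IsLocalRing.mem_maximalIdeal, mem_nonunits_iff, MvPowerSeries.isUnit_iff_constantCoeff, constantCoeff_X]
      exact not_isUnit_zero
    rw [RingHom.mem_ker, RingHom.comp_apply, hσX0, hκX0] at h1
    exact X_zero_ne_zero h1
  · -- `monicGerm d A ∈ P^d`
    refine mem_pow_of_inverse σ (τ₁.comp τ₂) hτσ (Q := RingHom.ker κ) (fun q hq => ?_) ?_
    · rw [RingHom.mem_ker, RingHom.comp_apply, hστ]
      exact hq
    · rw [hσ, subst_recentre_subst_shear3_monicGerm h hψ]
      exact monicGerm_mem_pow_of_isPermissibleTwoT hperm hκX1 hκX2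
  · -- `u₂ − u₁h ∈ P`
    rw [RingHom.mem_ker, RingHom.comp_apply, hσX1, hκX1]
  · -- `u₁ ∉ P`
    intro h1
    rw [RingHom.mem_ker, RingHom.comp_apply, hσX0, hκX0] at h1
    exact X_zero_ne_zero h1
  · -- plane `u₂`-free series meet `P` trivially
    intro G hG hGP
    rw [RingHom.mem_ker, RingHom.comp_apply, hσ, subst_shear3_rename, shear_eq_self_of_noY h G hG, subst_recentre_rename hψ, hκ,
      subst_kill_rename, TOT2Curve.killTwo_of_noY G hG] at hGP
    exact rename_injective _ (by rw [hGP, map_zero])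

/-- **THE READING IS INJECTIVE.**  A prime `P` with `u₁ ∉ P` meeting the `u₂`-free plane series trivially contains `u₂ − u₁h` for at most one
`u₂`-free `h`. -/
theorem eq_of_sub_mem_of_sub_mem {P : Ideal (MvPowerSeries (Fin 3) k)} (hP : P.IsPrime) (hX0 : (X 0 : MvPowerSeries (Fin 3) k) ∉ P)
    (hfix : ∀ G : MvPowerSeries (Fin 2) k, (∀ e : Fin 2 →₀ ℕ, e 1 ≠ 0 → coeff e G = 0) → rename (Fin.succAboveEmb (Fin.last 2)) G ∈ P → G = 0)
    {h h' : MvPowerSeries (Fin 2) k} (hh : ∀ e : Fin 2 →₀ ℕ, e 1 ≠ 0 → coeff e h = 0) (hh' : ∀ e : Fin 2 →₀ ℕ, e 1 ≠ 0 → coeff e h' = 0)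
    (h1 : X 1 - X 0 * rename (Fin.succAboveEmb (Fin.last 2)) h ∈ P) (h2 : X 1 - X 0 * rename (Fin.succAboveEmb (Fin.last 2)) h' ∈ P) :
    h = h' := by
  have h3 : (X 0 : MvPowerSeries (Fin 3) k) * rename (Fin.succAboveEmb (Fin.last 2)) (h' - h) ∈ P := by
    have h4 := Ideal.sub_mem P h1 h2
    rw [map_sub]
    have h5 : (X 1 - X 0 * rename (Fin.succAboveEmb (Fin.last 2)) h) - (X 1 - X 0 * rename (Fin.succAboveEmb (Fin.last 2)) h') =
        (X 0 : MvPowerSeries (Fin 3) k) * (rename (Fin.succAboveEmb (Fin.last 2)) h' - rename (Fin.succAboveEmb (Fin.last 2)) h) := by ring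
    rwa [h5] at h4
  rcases hP.mem_or_mem h3 with h4 | h4
  · exact absurd h4 hX0
  · have h5 := hfix (h' - h) (fun e he => by rw [map_sub, hh e he, hh' e he, sub_zero]) h4
    exact (sub_eq_zero.mp h5).symm

/-- **GRAPH DATA EMBED INTO THE FINITE PRIME INDEX SET.**  For a label with squarefree germ (`d ≥ 2`, `k` perfect of characteristic `p`),
the set of `u₂`-free `h` carrying a u₁-graph datum is finite — read through `exists_prime_of_graphDatum` inside the finite set of
`NCBranchPrimes.finite_primes_of_monicGerm_mem_pow`. -/
theorem finite_graphData (p : ℕ) [Fact p.Prime] [CharP k p] [PerfectRing k p] {d : ℕ} (hd : 2 ≤ d) (A : Fin d → MvPowerSeries (Fin 2) k)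
    (hsq : Squarefree (monicGerm d A)) :
    Set.Finite {h : MvPowerSeries (Fin 2) k | (∀ e : Fin 2 →₀ ℕ, e 1 ≠ 0 → coeff e h = 0) ∧
      ∃ ψ : MvPowerSeries (Fin 2) k, constantCoeff ψ = 0 ∧ IsPermissibleTwoT d (shift d (shearT h A) ψ)} := by
  classical
  -- choose the prime of each datum
  have hP : ∀ x : {h : MvPowerSeries (Fin 2) k // (∀ e : Fin 2 →₀ ℕ, e 1 ≠ 0 → coeff e h = 0) ∧
      ∃ ψ : MvPowerSeries (Fin 2) k, constantCoeff ψ = 0 ∧ IsPermissibleTwoT d (shift d (shearT h A) ψ)},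
      ∃ P : Ideal (MvPowerSeries (Fin 3) k), P.IsPrime ∧ P ≠ IsLocalRing.maximalIdeal (MvPowerSeries (Fin 3) k) ∧ monicGerm d A ∈ P ^ d ∧
        (X 1 - X 0 * rename (Fin.succAboveEmb (Fin.last 2)) x.1 ∈ P) ∧ (X 0 ∉ P) ∧
        (∀ G : MvPowerSeries (Fin 2) k, (∀ e : Fin 2 →₀ ℕ, e 1 ≠ 0 → coeff e G = 0) →
          rename (Fin.succAboveEmb (Fin.last 2)) G ∈ P → G = 0) := by
    rintro ⟨h, hh, ψ, hψ, hperm⟩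
    exact exists_prime_of_graphDatum A hh hψ hperm
  choose P hPprime hPmax hPgerm hPsub hPX0 hPfix using hP
  have hinj : Function.Injective P := by
    intro x y hxy
    apply Subtype.ext
    exact eq_of_sub_mem_of_sub_mem (hPprime x) (hPX0 x) (hPfix x) x.2.1 y.2.1 (hPsub x) (hxy ▸ hPsub y)
  have hfin := finite_primes_of_mem_pow p hsq hd
  haveI : Finite {P : Ideal (MvPowerSeries (Fin 3) k) | P.IsPrime ∧ P ≠ IsLocalRing.maximalIdeal (MvPowerSeries (Fin 3) k) ∧
      monicGerm d A ∈ P ^ d} := hfin.to_subtype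
  have hfinT : Finite {h : MvPowerSeries (Fin 2) k // (∀ e : Fin 2 →₀ ℕ, e 1 ≠ 0 → coeff e h = 0) ∧
      ∃ ψ : MvPowerSeries (Fin 2) k, constantCoeff ψ = 0 ∧ IsPermissibleTwoT d (shift d (shearT h A) ψ)} :=
    Finite.of_injective (fun x => (⟨P x, hPprime x, hPmax x, hPgerm x⟩ : {P : Ideal (MvPowerSeries (Fin 3) k) | P.IsPrime ∧
      P ≠ IsLocalRing.maximalIdeal (MvPowerSeries (Fin 3) k) ∧ monicGerm d A ∈ P ^ d})) (fun x y hxy => hinj (congrArg Subtype.val hxy))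
  exact Set.finite_coe_iff.mp hfinT

end NCBranchPrimes

end Summit.ResolutionOfSingularities.ResolutionOfSingularities.Theorems

end
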